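import Literature.NumberTheory.Automorphic.OrbitalMeasureCanonicalExistsCM     -- ★ compact-core facts, `localSplitEquiv` bridges, canonical families on `H_v`
import Literature.NumberTheory.Automorphic.WeylVanishingCanonical               -- ★ W-A3 the generic vanishing theorem
import Literature.NumberTheory.Automorphic.RegularTorusSaturationOpen           -- ★ W-B (op) at the matrix level
import Literature.LinearAlgebra.Matrix.RegularSemisimpleCentralizerGL            -- ★ W-C (ab)(zz)(w) at the matrix level
import Literature.LinearAlgebra.Matrix.SeparableCharpolyOpen                     -- ★ the regular locus is open
import Literature.NumberTheory.Rogawski1990.GRegularLocalisation                 -- ★ `isLocalGRegular_of_isConj`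
import Literature.Algebra.Polynomial.SeparablePi                                 -- ★ separability over `Π_{w∣v} L_w` is componentwise
import Literature.NumberTheory.Automorphic.AutomorphicLFunctionsProofs            -- ★ `GL_fin_one_mul_comm`
import HarnessLib

/-!
# The torus axioms of the Weyl vanishing theorem for `H_v = U(Φ₂)(L⁺_v) × U(Φ₁)(L⁺_v)` at a SPLIT place, and the vanishing
# theorem for `H_v` modulo conullity of the non-`G`-regular set
(Harish-Chandra (1970), Lemma 42; Rogawski (1990), §12.5 p. 182)

Topic `NumberTheory/Rogawski1990`; namespace `Literature.NumberTheory.Rogawski1990`.  Theorems only (no definition, no named fact,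
no instance, no `sorry`).  DOCKING file of the road «W1s soft Weyl» (cell `pub/hodgecm-mathlib`, P3b line «CMCharIdentityTest»,
stub `stub_weylVanishingSplit`): it discharges, on the `cmDatum` carriers of the letter and with `R = IsLocalGRegular L v`, the
hypotheses of ★ `WeylVanishingCanonical.integral_eq_zero_of_forall_classOrbitalIntegral_eq_zero` EXCEPT conullity of the
non-`G`-regular set, by transport along ★ `localSplitEquiv : U(Φ₂)(L⁺_v) ≃ₜ* GL₂(L_w)` (`v` split, `w ∣ v`, `c • w ≠ w`):
* §0 generic group lemmas: centralisers in a product, transport of centralisers along an isomorphism (★ `GL_fin_one_mul_comm` for `GL₁`),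
  and `index_subgroupOf_normalizer_centralizer_ne_zero_of_finite` (a finite set containing all `n γ n⁻¹`, `n ∈ N(Z(γ))`,
  forces `|N(Z(γ)) ∕ Z(γ)| < ∞`).
* §1 on `H_v` (★ `isRegularElt_fst_of_isLocalGRegular`: the `U(Φ₂)`-component of a `G`-regular element is regular semisimple):
  `local_one_comm` (`U(Φ₁)(L⁺_v)` is commutative at a split place), **`isOpen_setOf_isLocalGRegular_pi`**, **`centralizer_comm_of_isLocalGRegular'`**
  (ab), **`centralizer_eq_of_mem_of_isLocalGRegular`** (zz), **`index_subgroupOf_normalizer_centralizer_ne_zero_of_isLocalGRegular`** (w),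
  **`isOpen_iUnion_conj_centralizer_inter_isLocalGRegular`** (op), **`exists_isHaarMeasure_compactCore_centralizer_eq_one_of_isLocalGRegular`** (ex).
* §2 **`integral_eq_zero_of_forall_classOrbitalIntegral_eq_zero_of_conull`** — the stub's statement WITH ONE EXTRA HYPOTHESIS
  `νH {a | IsLocalGRegular L v a}ᶜ = 0` (conullity of the non-`G`-regular set — the last brick of the road, not proved here).
HONEST LABEL: HC_CM is proved only modulo the 2 remaining named inputs (hLiu418, h413) until rung 0 closes; this file discharges no
printed statement by itself.

## References
* [HarishChandra1970] Harish-Chandra (notes by G. van Dijk), *Harmonic Analysis on Reductive p-adic Groups*, LNM 162 (1970), Lemma 42.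
* [Rogawski1990] J. D. Rogawski, *Automorphic Representations of Unitary Groups in Three Variables* (1990), §12.5 p. 182, §3.1 p. 19.
-/

set_option autoImplicit false

noncomputable section

open MeasureTheory Measure Set Filter Topology NumberField IsDedekindDomain
open Literature.MeasureTheory.Group Literature.LinearAlgebra.Matrix
open scoped ENNReal NNReal Matrix MatrixGroups

/-! ## §0 Generic group lemmas -/

namespace Literature.NumberTheory.Rogawski1990

section Generic

/-- Centralisers in a product group are products of centralisers (membership form). [cite: HarishChandra1970, Lemma 42] -/
theorem mem_centralizer_prod_singleton_iff {A B : Type*} [Group A] [Group B] (a x : A × B) :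
    x ∈ Subgroup.centralizer ({a} : Set (A × B)) ↔
      x.1 ∈ Subgroup.centralizer ({a.1} : Set A) ∧ x.2 ∈ Subgroup.centralizer ({a.2} : Set B) := by
  simp only [Subgroup.mem_centralizer_singleton_iff, Prod.ext_iff, Prod.fst_mul, Prod.snd_mul]

/-- Transport of centralisers along a group isomorphism: `x ∈ Z(a) ⟺ e x ∈ Z(e a)`. [cite: HarishChandra1970, Lemma 42] -/
theorem mem_centralizer_singleton_iff_map {A B : Type*} [Group A] [Group B] (e : A ≃* B) (a x : A) :
    x ∈ Subgroup.centralizer ({a} : Set A) ↔ e x ∈ Subgroup.centralizer ({e a} : Set B) := by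
  rw [Subgroup.mem_centralizer_singleton_iff, Subgroup.mem_centralizer_singleton_iff, ← map_mul, ← map_mul,
    e.apply_eq_iff_eq]

/-- **Finite Weyl group from a finite set of conjugates**: if a finite set `S ⊆ G` contains `n γ n⁻¹` for every `n` in the
normaliser of `T = Z(γ)`, then `T` has finite index in `N(T)` (`n ↦ n γ n⁻¹` has fibres the cosets of `T`).
[cite: HarishChandra1970, Lemma 42] -/
theorem index_subgroupOf_normalizer_centralizer_ne_zero_of_finite {G : Type*} [Group G] (γ : G) {S : Set G} (hS : S.Finite)
    (h : ∀ n ∈ Subgroup.normalizer ((Subgroup.centralizer ({γ} : Set G) : Subgroup G) : Set G), n * γ * n⁻¹ ∈ S) :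
    ((Subgroup.centralizer ({γ} : Set G)).subgroupOf
      (Subgroup.normalizer ((Subgroup.centralizer ({γ} : Set G) : Subgroup G) : Set G))).index ≠ 0 := by
  classical
  set T : Subgroup G := Subgroup.centralizer ({γ} : Set G) with hT
  set Nm : Subgroup G := Subgroup.normalizer (T : Set G) with hNm
  let F : Nm → G := fun n => (n : G) * γ * (n : G)⁻¹
  have hrange : Set.range F ⊆ S := by
    rintro _ ⟨n, rfl⟩; exact h n n.2
  have hfin : (Set.range F).Finite := hS.subset hrange
  have hker : Setoid.ker F = QuotientGroup.leftRel (T.subgroupOf Nm) := by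
    ext n n'
    rw [Setoid.ker_def, QuotientGroup.leftRel_apply, Subgroup.mem_subgroupOf, hT, Subgroup.mem_centralizer_singleton_iff]
    change (n : G) * γ * (n : G)⁻¹ = (n' : G) * γ * (n' : G)⁻¹ ↔ ((n⁻¹ * n' : Nm) : G) * γ = γ * ((n⁻¹ * n' : Nm) : G)
    rw [Subgroup.coe_mul, Subgroup.coe_inv]
    constructor
    · intro h'
      calc ((n : G))⁻¹ * (n' : G) * γ = (n : G)⁻¹ * ((n' : G) * γ * (n' : G)⁻¹) * (n' : G) := by group
        _ = (n : G)⁻¹ * ((n : G) * γ * (n : G)⁻¹) * (n' : G) := by rw [← h']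
        _ = γ * ((↑n)⁻¹ * ↑n') := by group
    · intro h'
      symm
      calc (n' : G) * γ * (n' : G)⁻¹ = (n : G) * ((↑n)⁻¹ * ↑n' * γ) * (n' : G)⁻¹ := by group
        _ = (n : G) * (γ * ((↑n)⁻¹ * ↑n')) * (n' : G)⁻¹ := by rw [h']
        _ = (n : G) * γ * (n : G)⁻¹ := by group
  haveI : Finite (Quotient (Setoid.ker F)) := by
    haveI : Finite ↥(Set.range F) := hfin.to_subtype
    exact Finite.of_equiv _ (Setoid.quotientKerEquivRange F).symm
  haveI : Finite (Nm ⧸ T.subgroupOf Nm) := by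
    change Finite (Quotient (QuotientGroup.leftRel (T.subgroupOf Nm)))
    rw [← hker]; infer_instance
  exact Subgroup.index_ne_zero_of_finite

end Generic

/-! ## §1 The torus axioms on `H_v` at a split place -/

open Literature.NumberTheory.Automorphic Literature.NumberTheory.Automorphic.UnitaryGroup

section CMH

variable (L : Type) [Field L] [NumberField L] [IsCMField L] (v : HeightOneSpectrum (𝓞 ↥(maximalRealSubfield L)))
  (w : PlacesOver L v) (hw : IsCMField.complexConj L • w.1 ≠ w.1)

/-- The hermitian symmetry of `Φ₂`. [cite: Rogawski1990, §3.1 p. 19] -/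
theorem cm_antidiagTwo_map_transpose :
    ((Matrix.of fun i j : Fin 2 => if i.val + j.val + 1 = 2 then (1 : L) else 0).map (IsCMField.complexConj L))ᵀ = (Matrix.of fun i j : Fin 2 => if i.val + j.val + 1 = 2 then (1 : L) else 0) :=
  antidiagOne_map_transpose (IsCMField.complexConj L) 2

omit [IsCMField L] in
/-- `Φ₂` has unit determinant. [cite: Rogawski1990, §3.1 p. 19] -/
theorem cm_isUnit_det_antidiagTwo : IsUnit ((Matrix.of fun i j : Fin 2 => if i.val + j.val + 1 = 2 then (1 : L) else 0)).det := by
  have h : (Matrix.of fun i j : Fin 2 => if i.val + j.val + 1 = 2 then (1 : L) else 0) = !![0, 1; 1, 0] := by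
    ext i j; fin_cases i <;> fin_cases j <;> rfl
  rw [h, Matrix.det_fin_two_of]; norm_num

/-- `Φ₁` is hermitian. [cite: Rogawski1990, §3.1 p. 19] -/
theorem cm_antidiagOne_map_transpose :
    ((Matrix.of fun i j : Fin 1 => if i.val + j.val + 1 = 1 then (1 : L) else 0).map (IsCMField.complexConj L))ᵀ = (Matrix.of fun i j : Fin 1 => if i.val + j.val + 1 = 1 then (1 : L) else 0) :=
  antidiagOne_map_transpose (IsCMField.complexConj L) 1

omit [IsCMField L] in
/-- `Φ₁` has unit determinant. [cite: Rogawski1990, §3.1 p. 19] -/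
theorem cm_isUnit_det_antidiagOne : IsUnit ((Matrix.of fun i j : Fin 1 => if i.val + j.val + 1 = 1 then (1 : L) else 0)).det := by
  rw [Matrix.det_fin_one, Matrix.of_apply]; norm_num

include hw in
/-- **`U(Φ₁)(L⁺_v)` is commutative at a split place** (it is `GL₁(L_w)`, ★ `localSplitEquiv`). [cite: Rogawski1990, §3.1 p. 19] -/
theorem local_one_comm (a b : (UnitaryGroup.cmDatum L 1 (Matrix.of fun i j : Fin 1 => if i.val + j.val + 1 = 1 then (1 : L) else 0)).Local v) : a * b = b * a := by
  let e₁ : (UnitaryGroup.cmDatum L 1 (Matrix.of fun i j : Fin 1 => if i.val + j.val + 1 = 1 then (1 : L) else 0)).Local v ≃ₜ* GL (Fin 1) (w.1.adicCompletion L) :=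
    localSplitEquiv (IsCMField.complexConj L) _ (IsCMField.complexConj_ne_one L) (cm_antidiagOne_map_transpose L) w hw
      (isUnit_placeForm_of_isUnit_det (cm_isUnit_det_antidiagOne L) w.1)
  apply e₁.injective
  rw [map_mul, map_mul]
  exact GL_fin_one_mul_comm _ _

/-- **The `G`-regular set of `H_v` is open (at ANY finite place)**: `G`-regularity of `a` is separability of the characteristic
polynomial of `ι_v(a)` over `Π_{w′∣v} L_{w′}`, i.e. (★ `separable_iff_forall_map_evalRingHom`) separability of each `w′`-component, an
open condition (★ `isOpen_setOf_charpoly_separable` over the field `L_{w′}`).  (★ `LocalEndoscopicChartDatumCM.isOpen_setOf_isLocalGRegular`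
is the non-split case by the one-place model.) [cite: Rogawski1990, §4.3 p. 42] [cite: HarishChandra1970, Lemma 42] -/
theorem isOpen_setOf_isLocalGRegular_pi : IsOpen {a : ((UnitaryGroup.cmDatum L 2 (Matrix.of fun i j : Fin 2 => if i.val + j.val + 1 = 2 then (1 : L) else 0)).Local v × (UnitaryGroup.cmDatum L 1 (Matrix.of fun i j : Fin 1 => if i.val + j.val + 1 = 1 then (1 : L) else 0)).Local v) | IsLocalGRegular L v a} := by
  classical
  have hcont : ∀ w' : PlacesOver L v, Continuous fun a : ((UnitaryGroup.cmDatum L 2 (Matrix.of fun i j : Fin 2 => if i.val + j.val + 1 = 2 then (1 : L) else 0)).Local v × (UnitaryGroup.cmDatum L 1 (Matrix.of fun i j : Fin 1 => if i.val + j.val + 1 = 1 then (1 : L) else 0)).Local v) =>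
      (((endoEmbLocal L v a).val : GL (Fin 3) (UnitaryGroup.LocalRing L v)) : Matrix (Fin 3) (Fin 3) (UnitaryGroup.LocalRing L v)).map
        (Pi.evalRingHom (fun w : PlacesOver L v => w.1.adicCompletion L) w') := fun w' =>
    (Units.continuous_val.comp (continuous_subtype_val.comp (continuous_endoEmbLocal L v))).matrix_map (continuous_apply w')
  have hset : {a : ((UnitaryGroup.cmDatum L 2 (Matrix.of fun i j : Fin 2 => if i.val + j.val + 1 = 2 then (1 : L) else 0)).Local v × (UnitaryGroup.cmDatum L 1 (Matrix.of fun i j : Fin 1 => if i.val + j.val + 1 = 1 then (1 : L) else 0)).Local v) | IsLocalGRegular L v a} =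
      ⋂ w' : PlacesOver L v, (fun a : ((UnitaryGroup.cmDatum L 2 (Matrix.of fun i j : Fin 2 => if i.val + j.val + 1 = 2 then (1 : L) else 0)).Local v × (UnitaryGroup.cmDatum L 1 (Matrix.of fun i j : Fin 1 => if i.val + j.val + 1 = 1 then (1 : L) else 0)).Local v) => (((endoEmbLocal L v a).val : GL (Fin 3) (UnitaryGroup.LocalRing L v)) :
        Matrix (Fin 3) (Fin 3) (UnitaryGroup.LocalRing L v)).map (Pi.evalRingHom (fun w : PlacesOver L v => w.1.adicCompletion L) w')) ⁻¹'
        {x : Matrix (Fin 3) (Fin 3) (w'.1.adicCompletion L) | x.charpoly.Separable} := by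
    ext a
    have key : IsLocalGRegular L v a ↔ IsRegularElt ((endoEmbLocal L v a).val : GL (Fin 3) (UnitaryGroup.LocalRing L v)) := Iff.rfl
    rw [Set.mem_setOf_eq, key, isRegularElt_iff, Literature.Algebra.Polynomial.separable_iff_forall_map_evalRingHom]
    simp only [Set.mem_iInter, Set.mem_preimage, Set.mem_setOf_eq, Matrix.charpoly_map]
  rw [hset]
  exact isOpen_iInter_of_finite fun w' => isOpen_setOf_charpoly_separable.preimage (hcont w')

/-- **(ab) The centraliser of a `G`-regular element of `H_v` is commutative** (★ `compactCore_centralizer_local_facts_of_isRegularElt` on each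
factor, ★ `mul_comm_centralizer_prod`). [cite: Rogawski1990, §3.1 p. 19] [cite: HarishChandra1970, Lemma 42] -/
theorem centralizer_comm_of_isLocalGRegular' {γ : ((UnitaryGroup.cmDatum L 2 (Matrix.of fun i j : Fin 2 => if i.val + j.val + 1 = 2 then (1 : L) else 0)).Local v × (UnitaryGroup.cmDatum L 1 (Matrix.of fun i j : Fin 1 => if i.val + j.val + 1 = 1 then (1 : L) else 0)).Local v)} (hγ : IsLocalGRegular L v γ) :
    ∀ a ∈ Subgroup.centralizer ({γ} : Set ((UnitaryGroup.cmDatum L 2 (Matrix.of fun i j : Fin 2 => if i.val + j.val + 1 = 2 then (1 : L) else 0)).Local v × (UnitaryGroup.cmDatum L 1 (Matrix.of fun i j : Fin 1 => if i.val + j.val + 1 = 1 then (1 : L) else 0)).Local v)), ∀ b ∈ Subgroup.centralizer ({γ} : Set ((UnitaryGroup.cmDatum L 2 (Matrix.of fun i j : Fin 2 => if i.val + j.val + 1 = 2 then (1 : L) else 0)).Local v × (UnitaryGroup.cmDatum L 1 (Matrix.of fun i j : Fin 1 => if i.val + j.val + 1 = 1 then (1 : L) else 0)).Local v)), a * b =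 b * a := by
  have h₂ := isRegularElt_fst_of_isLocalGRegular L v γ hγ
  have h₁ : IsRegularElt (γ.2.val : GL (Fin 1) (UnitaryGroup.LocalRing L v)) := isRegularElt_of_fin_one _
  have f₂ := (compactCore_centralizer_local_facts_of_isRegularElt (IsCMField.complexConj L) 2 _ (IsCMField.complexConj_ne_one L)
    (cm_antidiagTwo_map_transpose L) (cm_isUnit_det_antidiagTwo L) γ.1 h₂).1
  have f₁ := (compactCore_centralizer_local_facts_of_isRegularElt (IsCMField.complexConj L) 1 _ (IsCMField.complexConj_ne_one L)
    (cm_antidiagOne_map_transpose L) (cm_isUnit_det_antidiagOne L) γ.2 h₁).1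
  intro a ha b hb
  obtain ⟨γ₂, γ₁⟩ := γ
  have hab := mul_comm_centralizer_prod (A := (UnitaryGroup.cmDatum L 2 (Matrix.of fun i j : Fin 2 => if i.val + j.val + 1 = 2 then (1 : L) else 0)).Local v) (B := (UnitaryGroup.cmDatum L 1 (Matrix.of fun i j : Fin 1 => if i.val + j.val + 1 = 1 then (1 : L) else 0)).Local v) γ₂ γ₁ f₂ f₁ ⟨a, ha⟩ ⟨b, hb⟩
  exact congrArg Subtype.val hab

include hw in
/-- **(zz) `Z(t) = Z(γ)` for every `G`-regular `t` in the centraliser of a `G`-regular `γ ∈ H_v`** (on the `U(Φ₂)`-factor: ★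
`centralizer_gl_eq_of_mem` transported along ★ `localSplitEquiv`; the `U(Φ₁)`-factor is commutative). [cite: HarishChandra1970, Lemma 42] -/
theorem centralizer_eq_of_mem_of_isLocalGRegular {γ t : ((UnitaryGroup.cmDatum L 2 (Matrix.of fun i j : Fin 2 => if i.val + j.val + 1 = 2 then (1 : L) else 0)).Local v × (UnitaryGroup.cmDatum L 1 (Matrix.of fun i j : Fin 1 => if i.val + j.val + 1 = 1 then (1 : L) else 0)).Local v)} (hγ : IsLocalGRegular L v γ)
    (ht : t ∈ Subgroup.centralizer ({γ} : Set ((UnitaryGroup.cmDatum L 2 (Matrix.of fun i j : Fin 2 => if i.val + j.val + 1 = 2 then (1 : L) else 0)).Local v × (UnitaryGroup.cmDatum L 1 (Matrix.of fun i j : Fin 1 => if i.val + j.val + 1 = 1 then (1 : L) else 0)).Local v))) (htR : IsLocalGRegular L v t) :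
    Subgroup.centralizer ({t} : Set ((UnitaryGroup.cmDatum L 2 (Matrix.of fun i j : Fin 2 => if i.val + j.val + 1 = 2 then (1 : L) else 0)).Local v × (UnitaryGroup.cmDatum L 1 (Matrix.of fun i j : Fin 1 => if i.val + j.val + 1 = 1 then (1 : L) else 0)).Local v)) = Subgroup.centralizer ({γ} : Set ((UnitaryGroup.cmDatum L 2 (Matrix.of fun i j : Fin 2 => if i.val + j.val + 1 = 2 then (1 : L) else 0)).Local v × (UnitaryGroup.cmDatum L 1 (Matrix.of fun i j : Fin 1 => if i.val + j.val + 1 = 1 then (1 : L) else 0)).Local v)) := by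
  let e₂ : (UnitaryGroup.cmDatum L 2 (Matrix.of fun i j : Fin 2 => if i.val + j.val + 1 = 2 then (1 : L) else 0)).Local v ≃ₜ* GL (Fin 2) (w.1.adicCompletion L) :=
    localSplitEquiv (IsCMField.complexConj L) _ (IsCMField.complexConj_ne_one L) (cm_antidiagTwo_map_transpose L) w hw
      (isUnit_placeForm_of_isUnit_det (cm_isUnit_det_antidiagTwo L) w.1)
  have hA : (((e₂ γ.1 : GL (Fin 2) (w.1.adicCompletion L))) : Matrix (Fin 2) (Fin 2) (w.1.adicCompletion L)).charpoly.Separable :=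
    (isRegularElt_iff _).1 (isRegularElt_localSplitEquiv_of_isRegularElt (IsCMField.complexConj L) w _ (IsCMField.complexConj_ne_one L) hw
      (cm_antidiagTwo_map_transpose L) _ γ.1 (isRegularElt_fst_of_isLocalGRegular L v γ hγ))
  have hT : (((e₂ t.1 : GL (Fin 2) (w.1.adicCompletion L))) : Matrix (Fin 2) (Fin 2) (w.1.adicCompletion L)).charpoly.Separable :=
    (isRegularElt_iff _).1 (isRegularElt_localSplitEquiv_of_isRegularElt (IsCMField.complexConj L) w _ (IsCMField.complexConj_ne_one L) hw
      (cm_antidiagTwo_map_transpose L) _ t.1 (isRegularElt_fst_of_isLocalGRegular L v t htR))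
  have ht₁ : e₂ t.1 ∈ Subgroup.centralizer ({e₂ γ.1} : Set (GL (Fin 2) (w.1.adicCompletion L))) :=
    (mem_centralizer_singleton_iff_map e₂.toMulEquiv γ.1 t.1).1 ((mem_centralizer_prod_singleton_iff γ t).1 ht).1
  have hZ₂ := centralizer_gl_eq_of_mem (e₂ γ.1) hA ht₁ hT
  ext x
  rw [mem_centralizer_prod_singleton_iff, mem_centralizer_prod_singleton_iff,
    mem_centralizer_singleton_iff_map e₂.toMulEquiv t.1 x.1, mem_centralizer_singleton_iff_map e₂.toMulEquiv γ.1 x.1]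
  change (e₂ x.1 ∈ Subgroup.centralizer ({e₂ t.1} : Set (GL (Fin 2) (w.1.adicCompletion L))) ∧ _) ↔
    (e₂ x.1 ∈ Subgroup.centralizer ({e₂ γ.1} : Set (GL (Fin 2) (w.1.adicCompletion L))) ∧ _)
  rw [hZ₂]
  have h1 : x.2 ∈ Subgroup.centralizer ({t.2} : Set ((UnitaryGroup.cmDatum L 1 (Matrix.of fun i j : Fin 1 => if i.val + j.val + 1 = 1 then (1 : L) else 0)).Local v)) :=
    Subgroup.mem_centralizer_singleton_iff.2 (local_one_comm L v w hw _ _)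
  have h2 : x.2 ∈ Subgroup.centralizer ({γ.2} : Set ((UnitaryGroup.cmDatum L 1 (Matrix.of fun i j : Fin 1 => if i.val + j.val + 1 = 1 then (1 : L) else 0)).Local v)) :=
    Subgroup.mem_centralizer_singleton_iff.2 (local_one_comm L v w hw _ _)
  simp only [h1, h2, and_true]

set_option synthInstance.maxHeartbeats 200000 in
include hw in
/-- **(w) The Weyl group of the centraliser of a `G`-regular element of `H_v` is finite**: every `n γ n⁻¹`, `n ∈ N(Z(γ))`, lies in
the finite set `e₂⁻¹{A, tr A·1 − A} × {γ₁}` (`A = e₂ γ₂`; ★ `eq_or_eq_of_mem_adjoin_of_trace_eq_of_det_eq`), so §0 applies.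
[cite: HarishChandra1970, Lemma 42] -/
theorem index_subgroupOf_normalizer_centralizer_ne_zero_of_isLocalGRegular {γ : ((UnitaryGroup.cmDatum L 2 (Matrix.of fun i j : Fin 2 => if i.val + j.val + 1 = 2 then (1 : L) else 0)).Local v × (UnitaryGroup.cmDatum L 1 (Matrix.of fun i j : Fin 1 => if i.val + j.val + 1 = 1 then (1 : L) else 0)).Local v)} (hγ : IsLocalGRegular L v γ) :
    ((Subgroup.centralizer ({γ} : Set ((UnitaryGroup.cmDatum L 2 (Matrix.of fun i j : Fin 2 => if i.val + j.val + 1 = 2 then (1 : L) else 0)).Local v × (UnitaryGroup.cmDatum L 1 (Matrix.of fun i j : Fin 1 => if i.val + j.val + 1 = 1 then (1 : L) else 0)).Local v))).subgroupOf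
      (Subgroup.normalizer ((Subgroup.centralizer ({γ} : Set ((UnitaryGroup.cmDatum L 2 (Matrix.of fun i j : Fin 2 => if i.val + j.val + 1 = 2 then (1 : L) else 0)).Local v × (UnitaryGroup.cmDatum L 1 (Matrix.of fun i j : Fin 1 => if i.val + j.val + 1 = 1 then (1 : L) else 0)).Local v)) : Subgroup ((UnitaryGroup.cmDatum L 2 (Matrix.of fun i j : Fin 2 => if i.val + j.val + 1 = 2 then (1 : L) else 0)).Local v × (UnitaryGroup.cmDatum L 1 (Matrix.of fun i j : Fin 1 => if i.val + j.val + 1 = 1 then (1 : L) else 0)).Local v)) : Set ((UnitaryGroup.cmDatum L 2 (Matrix.of fun i j : Fin 2 => if i.val + j.val + 1 = 2 then (1 : L) else 0)).Local v × (UnitaryGroup.cmDatum L 1 (Matrix.of fun i j : Fin 1 => if i.val + j.val + 1 = 1 then (1 : L) else 0)).Local v)))).index ≠ 0 := by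
  classical
  letI : NontriviallyNormedField (w.1.adicCompletion L) :=
    Valued.toNontriviallyNormedField (w.1.adicCompletion L) (WithZero (Multiplicative ℤ))
  haveI : CharZero (w.1.adicCompletion L) := charZero_of_injective_algebraMap (algebraMap L _).injective
  haveI : NeZero (2 : w.1.adicCompletion L) := inferInstance
  let e₂ : (UnitaryGroup.cmDatum L 2 (Matrix.of fun i j : Fin 2 => if i.val + j.val + 1 = 2 then (1 : L) else 0)).Local v ≃ₜ* GL (Fin 2) (w.1.adicCompletion L) :=
    localSplitEquiv (IsCMField.complexConj L) _ (IsCMField.complexConj_ne_one L) (cm_antidiagTwo_map_transpose L) w hw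
      (isUnit_placeForm_of_isUnit_det (cm_isUnit_det_antidiagTwo L) w.1)
  set A : GL (Fin 2) (w.1.adicCompletion L) := e₂ γ.1 with hAdef
  have hA : ((A : GL (Fin 2) (w.1.adicCompletion L)) : Matrix (Fin 2) (Fin 2) (w.1.adicCompletion L)).charpoly.Separable :=
    (isRegularElt_iff _).1 (isRegularElt_localSplitEquiv_of_isRegularElt (IsCMField.complexConj L) w _ (IsCMField.complexConj_ne_one L) hw
      (cm_antidiagTwo_map_transpose L) _ γ.1 (isRegularElt_fst_of_isLocalGRegular L v γ hγ))
  -- the finite set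
  let f : (UnitaryGroup.cmDatum L 2 (Matrix.of fun i j : Fin 2 => if i.val + j.val + 1 = 2 then (1 : L) else 0)).Local v → Matrix (Fin 2) (Fin 2) (w.1.adicCompletion L) := fun u => ((e₂ u : GL (Fin 2) (w.1.adicCompletion L)) : Matrix _ _ _)
  have hf : Function.Injective f := fun u u' h => e₂.injective (Units.ext h)
  set S₂ : Set ((UnitaryGroup.cmDatum L 2 (Matrix.of fun i j : Fin 2 => if i.val + j.val + 1 = 2 then (1 : L) else 0)).Local v) := f ⁻¹' {(A : Matrix (Fin 2) (Fin 2) (w.1.adicCompletion L)),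
    (A : Matrix (Fin 2) (Fin 2) (w.1.adicCompletion L)).trace • (1 : Matrix (Fin 2) (Fin 2) (w.1.adicCompletion L)) - A} with hS₂
  have hS₂fin : S₂.Finite := (Set.toFinite _).preimage hf.injOn
  refine index_subgroupOf_normalizer_centralizer_ne_zero_of_finite γ ((hS₂fin.prod (Set.finite_singleton γ.2))) fun n hn => ?_
  have hmem : n * γ * n⁻¹ ∈ Subgroup.centralizer ({γ} : Set ((UnitaryGroup.cmDatum L 2 (Matrix.of fun i j : Fin 2 => if i.val + j.val + 1 = 2 then (1 : L) else 0)).Local v × (UnitaryGroup.cmDatum L 1 (Matrix.of fun i j : Fin 1 => if i.val + j.val + 1 = 1 then (1 : L) else 0)).Local v)) := conj_mem_centralizer_of_mem_normalizer γ hn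
  rw [mem_centralizer_prod_singleton_iff] at hmem
  refine Set.mk_mem_prod ?_ ?_
  · -- the `U(Φ₂)`-component: `e₂ (n₂ γ₂ n₂⁻¹) = e₂ n₂ · A · (e₂ n₂)⁻¹ ∈ Z(A)` with the characteristic polynomial of `A`
    simp only [hS₂, Set.mem_preimage, Set.mem_insert_iff, Set.mem_singleton_iff]
    have h1 : (n * γ * n⁻¹).1 = n.1 * γ.1 * n.1⁻¹ := rfl
    have hB : e₂ (n * γ * n⁻¹).1 = e₂ n.1 * A * (e₂ n.1)⁻¹ := by rw [h1, map_mul, map_mul, map_inv]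
    have hBZ : e₂ (n * γ * n⁻¹).1 ∈ Subgroup.centralizer ({A} : Set (GL (Fin 2) (w.1.adicCompletion L))) :=
      (mem_centralizer_singleton_iff_map e₂.toMulEquiv γ.1 _).1 hmem.1
    have hadj := (mem_centralizer_gl_iff_mem_adjoin A hA _).1 hBZ
    have hchar : ((e₂ (n * γ * n⁻¹).1 : GL (Fin 2) (w.1.adicCompletion L)) : Matrix (Fin 2) (Fin 2) (w.1.adicCompletion L)).charpoly =
        (A : Matrix (Fin 2) (Fin 2) (w.1.adicCompletion L)).charpoly := by
      rw [hB]; exact charpoly_gl_conj _ _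
    have htr : ((e₂ (n * γ * n⁻¹).1 : GL (Fin 2) (w.1.adicCompletion L)) : Matrix (Fin 2) (Fin 2) (w.1.adicCompletion L)).trace =
        (A : Matrix (Fin 2) (Fin 2) (w.1.adicCompletion L)).trace := by
      rw [Matrix.trace_eq_neg_charpoly_coeff, Matrix.trace_eq_neg_charpoly_coeff, hchar]
    have hdet : ((e₂ (n * γ * n⁻¹).1 : GL (Fin 2) (w.1.adicCompletion L)) : Matrix (Fin 2) (Fin 2) (w.1.adicCompletion L)).det =
        (A : Matrix (Fin 2) (Fin 2) (w.1.adicCompletion L)).det := by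
      rw [Matrix.det_eq_sign_charpoly_coeff, Matrix.det_eq_sign_charpoly_coeff, hchar]
    exact eq_or_eq_of_mem_adjoin_of_trace_eq_of_det_eq (A : Matrix (Fin 2) (Fin 2) (w.1.adicCompletion L)) hA hadj htr hdet
  · -- the `U(Φ₁)`-component is `γ₁`
    change (n * γ * n⁻¹).2 ∈ ({γ.2} : Set ((UnitaryGroup.cmDatum L 1 (Matrix.of fun i j : Fin 1 => if i.val + j.val + 1 = 1 then (1 : L) else 0)).Local v))
    rw [Set.mem_singleton_iff]
    change n.2 * γ.2 * n.2⁻¹ = γ.2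
    rw [local_one_comm L v w hw n.2 γ.2, mul_inv_cancel_right]

set_option synthInstance.maxHeartbeats 200000 in
include hw in
/-- **(op) The regular saturation `⋃_x x (Z(γ) ∩ R) x⁻¹` of the centraliser of a `G`-regular `γ ∈ H_v` is open**: it is
`R ∩ {y | e₂ y₁ ∈ ⋃_{x'} x' (Z(e₂ γ₂) ∩ R_sep) x'⁻¹}` (`R` the `G`-regular set, open; ★ `isOpen_iUnion_conj_centralizer_inter_separable`
for the `GL₂(L_w)`-saturation). [cite: HarishChandra1970, Lemma 42] -/
theorem isOpen_iUnion_conj_centralizer_inter_isLocalGRegular {γ : ((UnitaryGroup.cmDatum L 2 (Matrix.of fun i j : Fin 2 => if i.val + j.val + 1 = 2 then (1 : L) else 0)).Local v × (UnitaryGroup.cmDatum L 1 (Matrix.of fun i j : Fin 1 => if i.val + j.val + 1 = 1 then (1 : L) else 0)).Local v)} (hγ : IsLocalGRegular L v γ) :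
    IsOpen (⋃ x : ((UnitaryGroup.cmDatum L 2 (Matrix.of fun i j : Fin 2 => if i.val + j.val + 1 = 2 then (1 : L) else 0)).Local v × (UnitaryGroup.cmDatum L 1 (Matrix.of fun i j : Fin 1 => if i.val + j.val + 1 = 1 then (1 : L) else 0)).Local v), (fun t : ((UnitaryGroup.cmDatum L 2 (Matrix.of fun i j : Fin 2 => if i.val + j.val + 1 = 2 then (1 : L) else 0)).Local v × (UnitaryGroup.cmDatum L 1 (Matrix.of fun i j : Fin 1 => if i.val + j.val + 1 = 1 then (1 : L) else 0)).Local v) => x * t * x⁻¹) ''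
      (((Subgroup.centralizer ({γ} : Set ((UnitaryGroup.cmDatum L 2 (Matrix.of fun i j : Fin 2 => if i.val + j.val + 1 = 2 then (1 : L) else 0)).Local v × (UnitaryGroup.cmDatum L 1 (Matrix.of fun i j : Fin 1 => if i.val + j.val + 1 = 1 then (1 : L) else 0)).Local v)) : Subgroup ((UnitaryGroup.cmDatum L 2 (Matrix.of fun i j : Fin 2 => if i.val + j.val + 1 = 2 then (1 : L) else 0)).Local v × (UnitaryGroup.cmDatum L 1 (Matrix.of fun i j : Fin 1 => if i.val + j.val + 1 = 1 then (1 : L) else 0)).Local v)) : Set ((UnitaryGroup.cmDatum L 2 (Matrix.of fun i j : Fin 2 => if i.val + j.val + 1 = 2 then (1 : L) else 0)).Local v × (UnitaryGroup.cmDatum L 1 (Matrix.of fun i j : Fin 1 => if i.val + j.val + 1 = 1 then (1 : L) else 0)).Local v)) ∩ {a | IsLocalGRegular L v a})) := by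
  classical
  letI : NontriviallyNormedField (w.1.adicCompletion L) :=
    Valued.toNontriviallyNormedField (w.1.adicCompletion L) (WithZero (Multiplicative ℤ))
  haveI : CharZero (w.1.adicCompletion L) := charZero_of_injective_algebraMap (algebraMap L _).injective
  let e₂ : (UnitaryGroup.cmDatum L 2 (Matrix.of fun i j : Fin 2 => if i.val + j.val + 1 = 2 then (1 : L) else 0)).Local v ≃ₜ* GL (Fin 2) (w.1.adicCompletion L) :=
    localSplitEquiv (IsCMField.complexConj L) _ (IsCMField.complexConj_ne_one L) (cm_antidiagTwo_map_transpose L) w hw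
      (isUnit_placeForm_of_isUnit_det (cm_isUnit_det_antidiagTwo L) w.1)
  set A : GL (Fin 2) (w.1.adicCompletion L) := e₂ γ.1 with hAdef
  have hreg : ∀ (s : ((UnitaryGroup.cmDatum L 2 (Matrix.of fun i j : Fin 2 => if i.val + j.val + 1 = 2 then (1 : L) else 0)).Local v × (UnitaryGroup.cmDatum L 1 (Matrix.of fun i j : Fin 1 => if i.val + j.val + 1 = 1 then (1 : L) else 0)).Local v)), IsLocalGRegular L v s →
      ((e₂ s.1 : GL (Fin 2) (w.1.adicCompletion L)) : Matrix (Fin 2) (Fin 2) (w.1.adicCompletion L)).charpoly.Separable := fun s hs =>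
    (isRegularElt_iff _).1 (isRegularElt_localSplitEquiv_of_isRegularElt (IsCMField.complexConj L) w _ (IsCMField.complexConj_ne_one L) hw
      (cm_antidiagTwo_map_transpose L) _ s.1 (isRegularElt_fst_of_isLocalGRegular L v s hs))
  have hA := hreg γ hγ
  -- the `GL₂(L_w)`-saturation, open by W-B
  set P' : Set (GL (Fin 2) (w.1.adicCompletion L)) := ⋃ x' : GL (Fin 2) (w.1.adicCompletion L),
    (fun t' : GL (Fin 2) (w.1.adicCompletion L) => x' * t' * x'⁻¹) ''
      (((Subgroup.centralizer ({A} : Set (GL (Fin 2) (w.1.adicCompletion L))) : Subgroup (GL (Fin 2) (w.1.adicCompletion L))) :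
        Set (GL (Fin 2) (w.1.adicCompletion L))) ∩
        {g | (g : Matrix (Fin 2) (Fin 2) (w.1.adicCompletion L)).charpoly.Separable}) with hP'
  have hP'o : IsOpen P' := isOpen_iUnion_conj_centralizer_inter_separable A hA
  -- the identification of the `H_v`-saturation
  have hset : (⋃ x : ((UnitaryGroup.cmDatum L 2 (Matrix.of fun i j : Fin 2 => if i.val + j.val + 1 = 2 then (1 : L) else 0)).Local v × (UnitaryGroup.cmDatum L 1 (Matrix.of fun i j : Fin 1 => if i.val + j.val + 1 = 1 then (1 : L) else 0)).Local v), (fun t : ((UnitaryGroup.cmDatum L 2 (Matrix.of fun i j : Fin 2 => if i.val + j.val + 1 = 2 then (1 : L) else 0)).Local v × (UnitaryGroup.cmDatum L 1 (Matrix.of fun i j : Fin 1 => if i.val + j.val + 1 = 1 then (1 : L) else 0)).Local v) => x * t * x⁻¹) ''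
      (((Subgroup.centralizer ({γ} : Set ((UnitaryGroup.cmDatum L 2 (Matrix.of fun i j : Fin 2 => if i.val + j.val + 1 = 2 then (1 : L) else 0)).Local v × (UnitaryGroup.cmDatum L 1 (Matrix.of fun i j : Fin 1 => if i.val + j.val + 1 = 1 then (1 : L) else 0)).Local v)) : Subgroup ((UnitaryGroup.cmDatum L 2 (Matrix.of fun i j : Fin 2 => if i.val + j.val + 1 = 2 then (1 : L) else 0)).Local v × (UnitaryGroup.cmDatum L 1 (Matrix.of fun i j : Fin 1 => if i.val + j.val + 1 = 1 then (1 : L) else 0)).Local v)) : Set ((UnitaryGroup.cmDatum L 2 (Matrix.of fun i j : Fin 2 => if i.val + j.val + 1 = 2 then (1 : L) else 0)).Local v × (UnitaryGroup.cmDatum L 1 (Matrix.of fun i j : Fin 1 => if i.val + j.val + 1 = 1 then (1 : L) else 0)).Local v)) ∩ {a | IsLocalGRegular L v a})) =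
      {a | IsLocalGRegular L v a} ∩ (fun y : ((UnitaryGroup.cmDatum L 2 (Matrix.of fun i j : Fin 2 => if i.val + j.val + 1 = 2 then (1 : L) else 0)).Local v × (UnitaryGroup.cmDatum L 1 (Matrix.of fun i j : Fin 1 => if i.val + j.val + 1 = 1 then (1 : L) else 0)).Local v) => e₂ y.1) ⁻¹' P' := by
    ext y
    simp only [mem_iUnion, mem_image, mem_inter_iff, SetLike.mem_coe, mem_setOf_eq, mem_preimage, hP']
    constructor
    · rintro ⟨x, t, ⟨htZ, htR⟩, rfl⟩
      refine ⟨isLocalGRegular_of_isConj (isConj_iff.2 ⟨x, rfl⟩) htR, e₂ x.1, e₂ t.1, ⟨?_, hreg t htR⟩, ?_⟩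
      · exact (mem_centralizer_singleton_iff_map e₂.toMulEquiv γ.1 t.1).1 ((mem_centralizer_prod_singleton_iff γ t).1 htZ).1
      · rw [show (x * t * x⁻¹).1 = x.1 * t.1 * x.1⁻¹ from rfl, map_mul, map_mul, map_inv]
    · rintro ⟨hyR, x', t', ⟨ht'Z, ht'R⟩, hxt⟩
      -- pull the `GL₂` data back along `e₂`
      refine ⟨(e₂.symm x', 1), (e₂.symm t', y.2), ⟨?_, ?_⟩, ?_⟩
      · rw [mem_centralizer_prod_singleton_iff]
        refine ⟨?_, Subgroup.mem_centralizer_singleton_iff.2 (local_one_comm L v w hw _ _)⟩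
        rw [mem_centralizer_singleton_iff_map e₂.toMulEquiv γ.1]
        change e₂ (e₂.symm t') ∈ Subgroup.centralizer ({A} : Set (GL (Fin 2) (w.1.adicCompletion L)))
        rw [e₂.apply_symm_apply]; exact ht'Z
      · -- `(e₂⁻¹ t', y₂) = x⁻¹ y x` is `G`-regular by conjugation invariance
        refine isLocalGRegular_of_isConj (isConj_iff.2 ⟨((e₂.symm x', 1) : ((UnitaryGroup.cmDatum L 2 (Matrix.of fun i j : Fin 2 => if i.val + j.val + 1 = 2 then (1 : L) else 0)).Local v × (UnitaryGroup.cmDatum L 1 (Matrix.of fun i j : Fin 1 => if i.val + j.val + 1 = 1 then (1 : L) else 0)).Local v))⁻¹, ?_⟩) hyR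
        refine Prod.ext ?_ ?_
        · change (e₂.symm x')⁻¹ * y.1 * (e₂.symm x')⁻¹⁻¹ = e₂.symm t'
          apply e₂.injective
          rw [map_mul, map_mul, inv_inv, map_inv, e₂.apply_symm_apply, e₂.apply_symm_apply, ← hxt]
          group
        · change (1 : (UnitaryGroup.cmDatum L 1 (Matrix.of fun i j : Fin 1 => if i.val + j.val + 1 = 1 then (1 : L) else 0)).Local v)⁻¹ * y.2 * (1 : (UnitaryGroup.cmDatum L 1 (Matrix.of fun i j : Fin 1 => if i.val + j.val + 1 = 1 then (1 : L) else 0)).Local v)⁻¹⁻¹ = y.2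
          group
      · refine Prod.ext ?_ ?_
        · change e₂.symm x' * e₂.symm t' * (e₂.symm x')⁻¹ = y.1
          apply e₂.injective
          rw [map_mul, map_mul, map_inv, e₂.apply_symm_apply, e₂.apply_symm_apply]
          exact hxt
        · change (1 : (UnitaryGroup.cmDatum L 1 (Matrix.of fun i j : Fin 1 => if i.val + j.val + 1 = 1 then (1 : L) else 0)).Local v) * y.2 * 1⁻¹ = y.2
          group
  rw [hset]
  exact (isOpen_setOf_isLocalGRegular_pi L v).inter (hP'o.preimage (e₂.continuous.comp continuous_fst))

set_option maxHeartbeats 800000 in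
set_option synthInstance.maxHeartbeats 200000 in
/-- **(ex) The centraliser of a `G`-regular element of `H_v` carries an inversion-invariant Haar measure of mass one on its compact
core** (the `∃ t` clause of ★ `IsCanonical`; verbatim the per-class input of ★ `exists_isCanonical_H_local`).
[cite: Rogawski1990, §4.3 (4.3.1) p. 43] [cite: HarishChandra1970, Lemma 42] -/
theorem exists_isHaarMeasure_compactCore_centralizer_eq_one_of_isLocalGRegular
    [MeasurableSpace ((UnitaryGroup.cmDatum L 2 (Matrix.of fun i j : Fin 2 => if i.val + j.val + 1 = 2 then (1 : L) else 0)).Local v × (UnitaryGroup.cmDatum L 1 (Matrix.of fun i j : Fin 1 => if i.val + j.val + 1 = 1 then (1 : L) else 0)).Local v)] [BorelSpace ((UnitaryGroup.cmDatum L 2 (Matrix.of fun i j : Fin 2 => if i.val + j.val + 1 = 2 then (1 : L) else 0)).Local v × (UnitaryGroup.cmDatum L 1 (Matrix.of fun i j : Fin 1 => if i.val + j.val + 1 = 1 then (1 : L) else 0)).Local v)] (γ₂ : (UnitaryGroup.cmDatum L 2 (Matrix.of fun i j : Fin 2 => if i.val + j.val + 1 = 2 then (1 : L) else 0)).Local v)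 (γ₁ : (UnitaryGroup.cmDatum L 1 (Matrix.of fun i j : Fin 1 => if i.val + j.val + 1 = 1 then (1 : L) else 0)).Local v) (hγ : IsLocalGRegular L v (γ₂, γ₁)) :
    ∃ t : Measure (Subgroup.centralizer ({(γ₂, γ₁)} : Set ((UnitaryGroup.cmDatum L 2 (Matrix.of fun i j : Fin 2 => if i.val + j.val + 1 = 2 then (1 : L) else 0)).Local v × (UnitaryGroup.cmDatum L 1 (Matrix.of fun i j : Fin 1 => if i.val + j.val + 1 = 1 then (1 : L) else 0)).Local v))),
      t.IsHaarMeasure ∧ t.IsInvInvariant ∧ t (compactCore (Subgroup.centralizer ({(γ₂, γ₁)} : Set ((UnitaryGroup.cmDatum L 2 (Matrix.of fun i j : Fin 2 => if i.val + j.val + 1 = 2 then (1 : L) else 0)).Local v × (UnitaryGroup.cmDatum L 1 (Matrix.of fun i j : Fin 1 => if i.val + j.val + 1 = 1 then (1 : L) else 0)).Local v)))) = 1 := by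
  have h₂ : IsRegularElt (γ₂.val : GL (Fin 2) (UnitaryGroup.LocalRing L v)) := isRegularElt_fst_of_isLocalGRegular L v (γ₂, γ₁) hγ
  have h₁ : IsRegularElt (γ₁.val : GL (Fin 1) (UnitaryGroup.LocalRing L v)) := isRegularElt_of_fin_one _
  have hc := IsCMField.complexConj_ne_one L
  refine exists_isHaarMeasure_compactCore_centralizer_prod_eq_one
    (A := (UnitaryGroup.cmDatum L 2 (Matrix.of fun i j : Fin 2 => if i.val + j.val + 1 = 2 then (1 : L) else 0)).Local v)
    (B := (UnitaryGroup.cmDatum L 1 (Matrix.of fun i j : Fin 1 => if i.val + j.val + 1 = 1 then (1 : L) else 0)).Local v)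
    γ₂ γ₁ ?_ ?_ ?_ ?_ ?_ ?_
  · exact (compactCore_centralizer_local_facts_of_isRegularElt (IsCMField.complexConj L) 2 _ hc (cm_antidiagTwo_map_transpose L)
      (cm_isUnit_det_antidiagTwo L) γ₂ h₂).1
  · exact (compactCore_centralizer_local_facts_of_isRegularElt (IsCMField.complexConj L) 1 _ hc (cm_antidiagOne_map_transpose L)
      (cm_isUnit_det_antidiagOne L) γ₁ h₁).1
  · exact (compactCore_centralizer_local_facts_of_isRegularElt (IsCMField.complexConj L) 2 _ hc (cm_antidiagTwo_map_transpose L)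
      (cm_isUnit_det_antidiagTwo L) γ₂ h₂).2.1
  · exact (compactCore_centralizer_local_facts_of_isRegularElt (IsCMField.complexConj L) 2 _ hc (cm_antidiagTwo_map_transpose L)
      (cm_isUnit_det_antidiagTwo L) γ₂ h₂).2.2
  · exact (compactCore_centralizer_local_facts_of_isRegularElt (IsCMField.complexConj L) 1 _ hc (cm_antidiagOne_map_transpose L)
      (cm_isUnit_det_antidiagOne L) γ₁ h₁).2.1
  · exact (compactCore_centralizer_local_facts_of_isRegularElt (IsCMField.complexConj L) 1 _ hc (cm_antidiagOne_map_transpose L)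
      (cm_isUnit_det_antidiagOne L) γ₁ h₁).2.2

end CMH

/-! ## §2 The vanishing theorem on `H_v` modulo conullity of the non-`G`-regular set -/

section Vanishing

variable (L : Type) [Field L] [NumberField L] [IsCMField L] (v : HeightOneSpectrum (𝓞 ↥(maximalRealSubfield L)))

set_option synthInstance.maxHeartbeats 200000 in
/-- **W1s MODULO CONULLITY.**  At a place `v` of `L⁺` split in `L`, for a Haar measure `νH` on `H_v = U(Φ₂)(L⁺_v) × U(Φ₁)(L⁺_v)`, a
CANONICAL orbital measure family `mH` for the `G`-regular classes, and a test function `g` (locally constant, compactly supported) all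
of whose `G`-regular class orbital integrals vanish: `∫ g dνH = 0` — PROVIDED the non-`G`-regular set is `νH`-null (`hRν`, the last
brick of the road).  ★ W-A3 with the torus axioms of §1. [cite: HarishChandra1970, Lemma 42] [cite: Rogawski1990, §12.5 p. 182] -/
theorem integral_eq_zero_of_forall_classOrbitalIntegral_eq_zero_of_conull
    (hs : ∃ w : PlacesOver L v, IsCMField.complexConj L • w.1 ≠ w.1)
    [MeasurableSpace ((UnitaryGroup.cmDatum L 2 (Matrix.of fun i j : Fin 2 => if i.val + j.val + 1 = 2 then (1 : L) else 0)).Local v × (UnitaryGroup.cmDatum L 1 (Matrix.of fun i j : Fin 1 => if i.val + j.val + 1 = 1 then (1 : L) else 0)).Local v)] [BorelSpace ((UnitaryGroup.cmDatum L 2 (Matrix.of fun i j : Fin 2 => if i.val + j.val + 1 = 2 then (1 : L) else 0)).Local v × (UnitaryGroup.cmDatum L 1 (Matrix.of fun i j : Fin 1 => if i.val + j.val + 1 = 1 then (1 : L) else 0)).Local v)] (νH : Measure ((UnitaryGroup.cmDatum L 2 (Matrix.of fun i j : Fin 2 => if i.val + j.val + 1 = 2 then (1 : L) else 0)).Local v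 × (UnitaryGroup.cmDatum L 1 (Matrix.of fun i j : Fin 1 => if i.val + j.val + 1 = 1 then (1 : L) else 0)).Local v)) [νH.IsHaarMeasure] [νH.IsMulRightInvariant]
    [∀ a : ((UnitaryGroup.cmDatum L 2 (Matrix.of fun i j : Fin 2 => if i.val + j.val + 1 = 2 then (1 : L) else 0)).Local v × (UnitaryGroup.cmDatum L 1 (Matrix.of fun i j : Fin 1 => if i.val + j.val + 1 = 1 then (1 : L) else 0)).Local v), MeasurableSpace (((UnitaryGroup.cmDatum L 2 (Matrix.of fun i j : Fin 2 => if i.val + j.val + 1 = 2 then (1 : L) else 0)).Local v × (UnitaryGroup.cmDatum L 1 (Matrix.of fun i j : Fin 1 => if i.val + j.val + 1 = 1 then (1 : L) else 0)).Local v) ⧸ Subgroup.centralizer ({a} : Set ((UnitaryGroup.cmDatum L 2 (Matrix.of fun i j : Fin 2 => if i.val + j.val + 1 = 2 then (1 : L) else 0)).Local v × (UnitaryGroup.cmDatum L 1 (Matrix.of fun i j : Fin 1 => if i.val + j.val + 1 = 1 then (1 : L) else 0)).Local v)))]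
    [∀ a : ((UnitaryGroup.cmDatum L 2 (Matrix.of fun i j : Fin 2 => if i.val + j.val + 1 = 2 then (1 : L) else 0)).Local v × (UnitaryGroup.cmDatum L 1 (Matrix.of fun i j : Fin 1 => if i.val + j.val + 1 = 1 then (1 : L) else 0)).Local v), BorelSpace (((UnitaryGroup.cmDatum L 2 (Matrix.of fun i j : Fin 2 => if i.val + j.val + 1 = 2 then (1 : L) else 0)).Local v × (UnitaryGroup.cmDatum L 1 (Matrix.of fun i j : Fin 1 => if i.val + j.val + 1 = 1 then (1 : L) else 0)).Local v) ⧸ Subgroup.centralizer ({a} : Set ((UnitaryGroup.cmDatum L 2 (Matrix.of fun i j : Fin 2 => if i.val + j.val + 1 = 2 then (1 : L) else 0)).Local v × (UnitaryGroup.cmDatum L 1 (Matrix.of fun i j : Fin 1 => if i.val + j.val + 1 = 1 then (1 : L) else 0)).Local v)))]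
    (mH : OrbitalMeasureFamily ((UnitaryGroup.cmDatum L 2 (Matrix.of fun i j : Fin 2 => if i.val + j.val + 1 = 2 then (1 : L) else 0)).Local v × (UnitaryGroup.cmDatum L 1 (Matrix.of fun i j : Fin 1 => if i.val + j.val + 1 = 1 then (1 : L) else 0)).Local v)) (hmH : mH.IsCanonical (IsLocalGRegular L v) νH)
    (hRν : νH {a | IsLocalGRegular L v a}ᶜ = 0)
    (g : ((UnitaryGroup.cmDatum L 2 (Matrix.of fun i j : Fin 2 => if i.val + j.val + 1 = 2 then (1 : L) else 0)).Local v × (UnitaryGroup.cmDatum L 1 (Matrix.of fun i j : Fin 1 => if i.val + j.val + 1 = 1 then (1 : L) else 0)).Local v) → ℂ) (hg : IsLocSmooth g)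
    (h0 : ∀ a : ((UnitaryGroup.cmDatum L 2 (Matrix.of fun i j : Fin 2 => if i.val + j.val + 1 = 2 then (1 : L) else 0)).Local v × (UnitaryGroup.cmDatum L 1 (Matrix.of fun i j : Fin 1 => if i.val + j.val + 1 = 1 then (1 : L) else 0)).Local v), IsLocalGRegular L v a → classOrbitalIntegral mH g (ConjClasses.mk a) = 0) :
    ∫ h, g h ∂νH = 0 := by
  obtain ⟨w, hw⟩ := hs
  have hm' : mH.IsCanonical (· ∈ {a : ((UnitaryGroup.cmDatum L 2 (Matrix.of fun i j : Fin 2 => if i.val + j.val + 1 = 2 then (1 : L) else 0)).Local v × (UnitaryGroup.cmDatum L 1 (Matrix.of fun i j : Fin 1 => if i.val + j.val + 1 = 1 then (1 : L) else 0)).Local v) | IsLocalGRegular L v a}) νH := hmH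
  exact integral_eq_zero_of_forall_classOrbitalIntegral_eq_zero νH (isOpen_setOf_isLocalGRegular_pi L v) hRν
    (fun x a ha => isLocalGRegular_of_isConj (isConj_iff.2 ⟨x, rfl⟩) ha)
    (fun γ hγ => centralizer_comm_of_isLocalGRegular' L v hγ)
    (fun γ hγ t ht htR => centralizer_eq_of_mem_of_isLocalGRegular L v w hw hγ ht htR)
    (fun γ hγ => index_subgroupOf_normalizer_centralizer_ne_zero_of_isLocalGRegular L v w hw hγ)
    (fun γ hγ => isOpen_iUnion_conj_centralizer_inter_isLocalGRegular L v w hw hγ)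
    (fun γ hγ => exists_isHaarMeasure_compactCore_centralizer_eq_one_of_isLocalGRegular L v γ.1 γ.2 hγ)
    hm' g (hg.continuous.integrable_of_hasCompactSupport hg.hasCompactSupport) (fun a ha => h0 a ha)

end Vanishing

end Literature.NumberTheory.Rogawski1990

end
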